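import Literature.Analysis.PDE.FrameOperator
import Literature.Analysis.PDE.QuasilinearCharts
import Mathlib.Analysis.InnerProductSpace.Adjoint
import HarnessLib

/-!
# The symbol operator of a quasilinear system in a framed chart (topic `Analysis/PDE`)

Layer (III), step 1b (first part), of the programme to prove short-time existence for
quasilinear strictly parabolic systems on a closed manifold (hypothesis `hQL` of
`Literature.Geometry.Riemannian.ricciFlow_shortTime_existence_of_quasilinear`). In a framed
chart `κ = (z, A, c)` the principal part of the operator of `hQL` is
`Σᵢᵢ' αᵢᵢ' D²û(y) (A bᵢ) (A bᵢ')` with the scalar coefficient matrix `α = a z (jet)`; this file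
puts it in the frame form of the linear theory (`FrameOperator.lean`):

* `symbOp κ b α = Σᵢᵢ' αᵢᵢ' ⟪A bᵢ', ·⟫ A bᵢ` — the symbol operator on the model `E'`;
* `principalPart_symbOp` — `principalPart (symbOp κ b α) v y = Σᵢᵢ' αᵢᵢ' D²v(y) (A bᵢ) (A bᵢ')`
  for `v` of class `C²` near `y`;
* `adjoint_symbOp` — symmetric `α` give self-adjoint symbol operators;
* `inner_symbOp_self`, `inner_symbOp_self_pos` — `⟪S ξ, ξ⟫ = Σ αᵢᵢ' ξ̃ᵢ ξ̃ᵢ'` with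
  `ξ̃ᵢ = ⟪A bᵢ, ξ⟫`, positive for `ξ ≠ 0` when `α` is positive definite (Legendre condition).

Everything is proved; no named fact and no `sorry` is introduced.

## References

* C. Mantegazza, L. Martinazzi, *A note on quasilinear parabolic equations on manifolds*,
  Ann. Sc. Norm. Super. Pisa Cl. Sci. (5) 11 (2012), 857–874, §2. [MantegazzaMartinazzi2012]
* L. Hörmander, *The Analysis of Linear Partial Differential Operators III*, Springer 1985,
  §17.1. [Hormander1985III]
-/

noncomputable section

open Set Function Filter Topology InnerProductSpace
open scoped Manifold ContDiff RealInnerProductSpace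

namespace Literature.Analysis.PDE

open Literature.Geometry.Manifold

variable {E : Type*} [NormedAddCommGroup E] [NormedSpace ℝ E] {H : Type*} [TopologicalSpace H]
variable {I : ModelWithCorners ℝ E H} {M : Type*} [TopologicalSpace M] [ChartedSpace H M]
variable {E' : Type*} [NormedAddCommGroup E'] [InnerProductSpace ℝ E'] [FiniteDimensional ℝ E']
variable {F : Type*} [NormedAddCommGroup F] [NormedSpace ℝ F]
variable {ι : Type*} [Fintype ι]
variable (κ : FramedChart I M E') (b : Module.Basis ι ℝ E)

/-! ### The symbol operator -/

/-- **The symbol operator** of the coefficient matrix `α` in the framed chart: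
`S ξ = Σᵢᵢ' αᵢᵢ' ⟪A bᵢ', ξ⟫ A bᵢ`. [cite: Hormander1985III, §17.1] -/
def symbOp (α : ι → ι → ℝ) : E' →L[ℝ] E' :=
  ∑ i, ∑ i', α i i' • (innerSL ℝ (κ.A (b i'))).smulRight (κ.A (b i))

omit [FiniteDimensional ℝ E'] in
/-- `symbOp_apply`: `S ξ = Σᵢᵢ' αᵢᵢ' ⟪A bᵢ', ξ⟫ A bᵢ`. [folklore] -/
theorem symbOp_apply (α : ι → ι → ℝ) (ξ : E') :
    symbOp κ b α ξ = ∑ i, ∑ i', α i i' • (⟪κ.A (b i'), ξ⟫ • κ.A (b i)) := by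
  simp only [symbOp, FunLike.coe_sum, Finset.sum_apply, FunLike.coe_smul, Pi.smul_apply,
    ContinuousLinearMap.smulRight_apply, innerSL_apply_apply]

/-- Directional derivatives are linear in the direction through the frame:
`Σₗ ⟪w, bₗ⟫ ∂ₗ v(z) = ∂_w v(z)`. [folklore] -/
theorem sum_inner_smul_fderiv_apply (v : E' → F) (z w : E') :
    ∑ l, ⟪w, stdOrthonormalBasis ℝ E' l⟫ • fderiv ℝ v z (stdOrthonormalBasis ℝ E' l) = fderiv ℝ v z w := by
  conv_rhs => rw [← (stdOrthonormalBasis ℝ E').sum_repr' w]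
  rw [map_sum]
  refine Finset.sum_congr rfl fun l _ ↦ ?_
  rw [map_smul, real_inner_comm]

omit [FiniteDimensional ℝ E'] in
/-- Second derivatives in frame form: for `v` of class `C²` on an open `U ∋ y`,
`∂_w (z ↦ ∂_u v(z)) (y) = D²v(y) w u`. [folklore] -/
theorem fderiv_fderiv_apply_eq {U : Set E'} (hU : IsOpen U) {y : E'} (hyU : y ∈ U) {v : E' → F} (hv : ContDiffOn ℝ 2 v U) (u w : E') :
    fderiv ℝ (fun z ↦ fderiv ℝ v z u) y w = fderiv ℝ (fderiv ℝ v) y w u := by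
  have hD : DifferentiableAt ℝ (fderiv ℝ v) y :=
    ((hv.fderiv_of_isOpen (m := 1) hU (by norm_num)).differentiableOn one_ne_zero).differentiableAt (hU.mem_nhds hyU)
  rw [fderiv_clm_apply hD (differentiableAt_const u)]
  simp

/-- **The principal part of the symbol operator**: for `v` of class `C²` on an open `U ∋ y`,
`principalPart (symbOp κ b α) v y = Σᵢᵢ' αᵢᵢ' D²v(y) (A bᵢ) (A bᵢ')`.
[cite: Hormander1985III, §17.1] -/
theorem principalPart_symbOp (α : ι → ι → ℝ) {U : Set E'} (hU : IsOpen U) {y : E'} (hyU : y ∈ U) {v : E' → F}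
    (hv : ContDiffOn ℝ 2 v U) :
    principalPart (symbOp κ b α) v y = ∑ i, ∑ i', α i i' • fderiv ℝ (fderiv ℝ v) y (κ.A (b i)) (κ.A (b i')) := by
  -- linearity of a continuous linear map through the frame
  have hlin : ∀ (T : E' →L[ℝ] F) (w : E'), ∑ l, ⟪w, stdOrthonormalBasis ℝ E' l⟫ • T (stdOrthonormalBasis ℝ E' l) = T w := by
    intro T w
    conv_rhs => rw [← (stdOrthonormalBasis ℝ E').sum_repr' w]
    rw [map_sum]
    refine Finset.sum_congr rfl fun l _ ↦ ?_
    rw [map_smul, real_inner_comm]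
  rw [principalPart_eq_sum_fderiv_fderiv]
  simp only [symbOp_apply, map_sum, map_smul]
  rw [Finset.sum_comm]
  refine Finset.sum_congr rfl fun i _ ↦ ?_
  rw [Finset.sum_comm]
  refine Finset.sum_congr rfl fun i' _ ↦ ?_
  simp only [fderiv_fderiv_apply_eq hU hyU hv, ← Finset.smul_sum]
  rw [hlin]

/-! ### Symmetry and positivity -/

omit [FiniteDimensional ℝ E'] in
/-- `⟪S ξ, ζ⟫ = Σᵢᵢ' αᵢᵢ' ⟪A bᵢ', ξ⟫ ⟪A bᵢ, ζ⟫`. [folklore] -/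
theorem inner_symbOp (α : ι → ι → ℝ) (ξ ζ : E') :
    ⟪symbOp κ b α ξ, ζ⟫ = ∑ i, ∑ i', α i i' * (⟪κ.A (b i'), ξ⟫ * ⟪κ.A (b i), ζ⟫) := by
  rw [symbOp_apply, sum_inner]
  refine Finset.sum_congr rfl fun i _ ↦ ?_
  rw [sum_inner]
  refine Finset.sum_congr rfl fun i' _ ↦ ?_
  rw [real_inner_smul_left, real_inner_smul_left]

/-- **Symmetric coefficients give self-adjoint symbol operators.** [cite: Hormander1985III, §17.1] -/
theorem adjoint_symbOp {α : ι → ι → ℝ} (hα : ∀ i i', α i i' = α i' i) :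
    ContinuousLinearMap.adjoint (symbOp κ b α) = symbOp κ b α := by
  symm
  rw [ContinuousLinearMap.eq_adjoint_iff]
  intro ξ ζ
  rw [inner_symbOp, ← real_inner_comm, inner_symbOp, Finset.sum_comm]
  refine Finset.sum_congr rfl fun i _ ↦ Finset.sum_congr rfl fun i' _ ↦ ?_
  rw [hα i' i]
  ring

omit [FiniteDimensional ℝ E'] in
/-- `⟪S ξ, ξ⟫ = Σᵢᵢ' αᵢᵢ' ξ̃ᵢ ξ̃ᵢ'` with `ξ̃ᵢ = ⟪A bᵢ, ξ⟫` (for symmetric `α`). [folklore] -/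
theorem inner_symbOp_self (α : ι → ι → ℝ) (ξ : E') :
    ⟪symbOp κ b α ξ, ξ⟫ = ∑ i, ∑ i', α i i' * ⟪κ.A (b i), ξ⟫ * ⟪κ.A (b i'), ξ⟫ := by
  rw [inner_symbOp]
  refine Finset.sum_congr rfl fun i _ ↦ Finset.sum_congr rfl fun i' _ ↦ ?_
  ring

omit [FiniteDimensional ℝ E'] in
/-- The frame coefficients `ξ̃ᵢ = ⟪A bᵢ, ξ⟫` of a nonzero vector do not all vanish (the `A bᵢ`
span the model). [folklore] -/
theorem frameCoeff_ne_zero {ξ : E'} (hξ : ξ ≠ 0) : (fun i ↦ ⟪κ.A (b i), ξ⟫) ≠ 0 := by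
  intro h0
  apply hξ
  -- `ξ` is orthogonal to all `A bᵢ`, which span `E'`
  have horth : ∀ i, ⟪κ.A (b i), ξ⟫ = 0 := fun i ↦ congrFun h0 i
  have hspan : ∀ x : E', ⟪x, ξ⟫ = 0 := by
    intro x
    obtain ⟨η, rfl⟩ : ∃ η, κ.A η = x := ⟨κ.A.symm x, κ.A.apply_symm_apply x⟩
    have hη := b.sum_repr η
    rw [← hη, map_sum, sum_inner]
    refine Finset.sum_eq_zero fun i _ ↦ ?_
    rw [map_smul, real_inner_smul_left, horth i, mul_zero]
  exact inner_self_eq_zero.1 (hspan ξ)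

omit [FiniteDimensional ℝ E'] in
/-- **Positive definite coefficients give positive symbol operators** (Legendre condition):
`0 < ⟪S ξ, ξ⟫` for `ξ ≠ 0`. [cite: MantegazzaMartinazzi2012, §2] -/
theorem inner_symbOp_self_pos {α : ι → ι → ℝ}
    (hpos : ∀ ξ' : ι → ℝ, ξ' ≠ 0 → 0 < ∑ i, ∑ i', α i i' * ξ' i * ξ' i') {ξ : E'} (hξ : ξ ≠ 0) :
    0 < ⟪symbOp κ b α ξ, ξ⟫ := by
  rw [inner_symbOp_self κ b α]
  exact hpos _ (frameCoeff_ne_zero κ b hξ)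

end Literature.Analysis.PDE
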